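import Summits.CriticalPhenomena.CardyFormulaZ2.Theorems.CardyBoundaryCoulombGasRectilinearCardyDensityIntegration
import Summits.CriticalPhenomena.CardyFormulaZ2.Theorems.CardyBoundaryCoulombGasBoundaryDefectGaussianRStubTransferV2
import Summits.CriticalPhenomena.CardyFormulaZ2.Theorems.CardyBoundaryCoulombGasBoundaryDefectGaussianRStubReferenceLimitPart7
import Summits.CriticalPhenomena.CardyFormulaZ2.Theorems.CardyBoundaryCoulombGasBoundaryDefectGaussianRStubGreenKernelAsymptoticsPart5
import Summits.CriticalPhenomena.CardyFormulaZ2.Theorems.CardyBoundaryCoulombGasBoundaryDefectGaussianRHardness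
import Summits.CriticalPhenomena.CardyFormulaZ2.Theorems.CardyBoundaryCoulombGasAssembly
import Literature.Probability.LatticeModels.FlatBoundaryPoissonKernelLimitProofs
import Literature.Probability.LatticeModels.BoundaryNormalisedPoissonKernelLimitProofs
import HarnessLib

/-!
# Line `rigidity-tallbox-anchor` — skeleton v1 for crux `RectilinearCardy`
# (stmt-CriticalPhenomena-5660, route `CardyBoundaryCoulombGas`, sub-problem `CardyFormulaZ2`)

Crux-strategist seat `cstrat-stmt-CriticalPhenomena-5660-r1` (BC2 REDIRECT of the route re-audit, human rulings
2026-08-16 20:3x / 21:1x / 23:0x CDT). Card: `Lines/rigidity-tallbox-anchor.md`; certificate `SPLIT-r1.md`;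
census `STRATEGY-CENSUS.md` (§ r1).

## Why this line exists

The crux is the sub-problem in costume (`rectilinearCardy_iff_cardyFormulaZ2`, landed), and the picked line
`excursion-kernel-covariance` (skeleton v15, lead c18) is closed modulo ONE stub, `stub_engine1311` = the
`(4;(1,3,1,1);1)` member of the engine `BoundaryDefectGaussianR` (stmt-14132) — a single summit-strength leaf with no
known converse (rule N), which the 23:0x ruling sends back: "split the open piece into ≥ 2 planned, non-equivalent
pieces with the assembly proved". This skeleton IS that split, read at the level of this crux. It replaces the one
leaf by the engine strategist's cut of the engine (line `tall-box-integrable-anchor` of stmt-14132, STRATEGY-CENSUS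
of that crux, §Decomposition) and closes `RectilinearCardy` BY NAME through landed theorems only:

* `stub_rigidity` — RIGIDITY (conformal COVARIANCE of Green-normalised rainbow log-ratios across rectilinear
  geometries discretised along one mesh; sharpness-free, blind to a common mesh factor; the summit-shared core).
* `stub_tallBoxLimit` — TALL-BOX LIMIT (SHARPNESS, covariance-free: convergence of ONE numerical family on the tall
  lattice boxes `[-W,W]×[-W,W·W]`, where the bottom-row hull law is the stationary law of the free-wall
  Temperley–Lieb(1) chain — the integrable anchor: reflecting qKZ / VSASM ground state, Di Francesco–Zinn-Justin 2007,
  Mitra–Nienhuis–de Gier–Batchelor 2004).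
* `stub_anchorTransfer` — ANCHOR TRANSFER (RSW technology: tall box + rigidity ⇒ the registered CANONICAL LIMIT on
  the square; hard-way crossing cost `e^{-cA}` above height `2A`, arm separation, harmonic measure of the far end).

The three statements are IDENTICAL (verbatim) to the three registered stubs of stmt-14132's line
`tall-box-integrable-anchor` (Cruxes/BoundaryDefectGaussianR/Lines/tall_box_integrable_anchor.lean): they are shared
by reference, not re-hosted — stub-workers and the lead belong to stmt-14132; this crux stays parked
`blocked-on: stmt-CriticalPhenomena-14132` and closes mechanically behind it. What the registration buys HERE: the
registered decomposition of `RectilinearCardy` is no longer one summit-strength leaf but two open pieces of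
different nature (covariance ∣ sharpness) + one RSW transfer, assembled by a NON-trivial landed chain.

Composition (all landed): `stub_anchorTransfer stub_tallBoxLimit stub_rigidity : CANON`;
`refV2_of_canonicalLimit` (reference limit on the square) ▸ `stub_transferV2` (flat-mark conformal geometry, limit
algebra) with `greenKernelAsymptotics_of_facts` (Kenyon 2000 / Chelkak–Smirnov 2011 Poisson-kernel facts, both
proved) gives the ENGINE `BoundaryDefectGaussianR`; `Theorems.DensityIntegration_proof` (lattice bridge ▸
realisation ▸ uniformisation ▸ density integration, stmt-14890, ≈ 100 files) gives the crux.

Positions recorded (landed certificates re-used): the hypotheses give the sub-problem `CardyFormulaZ2`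
(`RectilinearSuffices_proof`) and crux 6 `HalfPlaneOneArmThird` already from TALL BOX + ANCHOR + RIGIDITY through
the canonical limit (`halfPlaneOneArmThird_of_canonicalLimit`). Disproof.lean (5660, v8) honoured: no
`_false_without_`, no `-- Targets` entry bears on these stubs; Disproof.lean (14132, cycle 2 v5) likewise
(see the 14132 line's header). BC2 piece probes: `SPLIT-r1.md` §(c).
-/

noncomputable section

open Filter Topology

namespace Summit.CriticalPhenomena.CardyFormulaZ2.Cruxes.RectilinearCardy.RigidityTallBoxAnchor

open Summit.CriticalPhenomena.CardyFormulaZ2.Cruxes.BoundaryDefectGaussianR.RainbowMonomialsInExcursionKernels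
  (stub_transferV2 refV2_of_canonicalLimit greenKernelAsymptotics_of_facts halfPlaneOneArmThird_of_canonicalLimit)

/-- **Stub 1 — RIGIDITY (covariance, sharpness-free; the summit-shared core).** Verbatim `stub_rigidity` of
stmt-14132's line `tall-box-integrable-anchor` = hypothesis 1 of the landed `stub_transferV2` = conclusion of the
landed `s3_rigidityOfTransportV3` (so it follows from point transport + rainbow locality of the v7 line, but is
strictly weaker: C⁰, blind to a common mesh factor). Why plausibly true: conformal covariance of RATIOS of rainbow
probabilities = CI of the scaling limit + point-to-arc fusion (Camia 2023 scheme on 𝕋; Garban–Pete–Schramm 2013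
ratio limits are RSW technology); exactly solvable in strip geometries. Size XL, open; ⇒ RectilinearCardy through
the `(1,1,1;3)` family + total mass (unproved reading), ⇒ HalfPlaneOneArmThird only together with a sharp anchor.
[cite: Camia2023] [cite: GarbanPeteSchramm2013Pivotal] -/
theorem stub_rigidity :
    ∀ (k : ℕ) (L : Fin k → ℕ) (j : Fin k), L j = ∑ i ∈ Finset.univ.erase j, L i → ∀ (D D' : Literature.Probability.RandomPlanarGeometry.MarkedDomain k), (∃ S : Finset (ℂ × ℂ), (∀ q ∈ S, q.1.re = q.2.re ∨ q.1.im = q.2.im) ∧ frontier D.carrier ⊆ ⋃ q ∈ S, segment ℝ q.1 q.2) → (∀ i, (∃ r : ℝ, 0 < r ∧ ((∀ z ∈ frontier D.carrier, dist z (D.pt i) < r → z.im = (D.pt i).im) ∨ (∀ z ∈ frontier D.carrier, dist z (D.pt i) < r → z.re = (D.pt i).re)))) → (∃ τ : ℂ, ‖τ‖ = 1 ∧ (∃ ε : ℝ, 0 < ε ∧ ∀ t ∈ Set.Ioo (D.mark j) (D.mark j + ε), ∃ s : ℝ, 0 < s ∧ D.boundary t = D.pt j + (s : ℂ) * τ)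 ∧ (∃ ε : ℝ, 0 < ε ∧ ∀ s ∈ Set.Ioo (0 : ℝ) ε, D.pt j + (s : ℂ) * (τ * Complex.I) ∈ D.carrier)) → (∃ S : Finset (ℂ × ℂ), (∀ q ∈ S, q.1.re = q.2.re ∨ q.1.im = q.2.im) ∧ frontier D'.carrier ⊆ ⋃ q ∈ S, segment ℝ q.1 q.2) → (∀ i, (∃ r : ℝ, 0 < r ∧ ((∀ z ∈ frontier D'.carrier, dist z (D'.pt i) < r → z.im = (D'.pt i).im) ∨ (∀ z ∈ frontier D'.carrier, dist z (D'.pt i) < r → z.re = (D'.pt i).re)))) → (∃ τ : ℂ, ‖τ‖ = 1 ∧ (∃ ε : ℝ, 0 < ε ∧ ∀ t ∈ Set.Ioo (D'.mark j) (D'.mark j + ε), ∃ s : ℝ, 0 < s ∧ D'.boundary t = D'.pt j + (s : ℂ) * τ) ∧ (∃ ε : ℝ, 0 < ε ∧ ∀ s ∈ Set.Ioo (0 : ℝ) ε, D'.pt j + (s : ℂ) * (τ * Complex.I) ∈ D'.carrier)) → ∀ (δ : ℕ → ℝ), (∀ n, 0 < δ n) → Filter.Tendsto δ Filter.atTop (nhds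 0) → ∀ (V V' : ℕ → Finset (ℤ × ℤ)), (∀ n, ∀ v : ℤ × ℤ, v ∈ V n ↔ (((v).1 : ℂ) * ((δ n : ℝ) : ℂ) + ((v).2 : ℂ) * ((δ n : ℝ) : ℂ) * Complex.I) ∈ closure D.carrier) → (∀ n, ∀ v : ℤ × ℤ, v ∈ V' n ↔ (((v).1 : ℂ) * ((δ n : ℝ) : ℂ) + ((v).2 : ℂ) * ((δ n : ℝ) : ℂ) * Complex.I) ∈ closure D'.carrier) → ∀ (p p' : ℕ → Fin k → ℤ × ℤ), (∀ n, Function.Injective ((p) n)) → (∀ n, Function.Injective ((p') n)) → (∀ i, Filter.Tendsto (fun n ↦ ((((p) n i).1 : ℂ) * ((δ n : ℝ) : ℂ) + (((p) n i).2 : ℂ) * ((δ n : ℝ) : ℂ) * Complex.I)) Filter.atTop (nhds (D.pt i))) → (∀ i, Filter.Tendsto (fun n ↦ ((((p') n i).1 : ℂ) * ((δ n : ℝ) : ℂ) + (((p') n i).2 : ℂ) * ((δ n : ℝ) : ℂ) * Complex.I)) Filter.atTop (nhds (D'.pt i))) → (∀ n, Literature.Probability.LatticeModels.CollarLegModel.LegInsertionData.IsAdmissible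 (⟨(Finset.univ.erase j).image ((p) n), fun v ↦ ∑ b ∈ (Finset.univ.erase j).filter (fun b ↦ ((p) n) b = v), L b, ((p) n) j⟩ : Literature.Probability.LatticeModels.CollarLegModel.LegInsertionData) (V n)) → (∀ n, Literature.Probability.LatticeModels.CollarLegModel.LegInsertionData.IsAdmissible (⟨(Finset.univ.erase j).image ((p') n), fun v ↦ ∑ b ∈ (Finset.univ.erase j).filter (fun b ↦ ((p') n) b = v), L b, ((p') n) j⟩ : Literature.Probability.LatticeModels.CollarLegModel.LegInsertionData) (V' n)) → (∀ᶠ n in Filter.atTop, 0 < (‖Literature.Probability.LatticeModels.CollarLegModel.Zins (V n) (⟨(Finset.univ.erase j).image (p n), fun v ↦ ∑ b ∈ (Finset.univ.erase j).filter (fun b ↦ (p n) b = v), L b, (p n) j⟩ : Literature.Probability.LatticeModels.CollarLegModel.LegInsertionData)‖ / ‖(Literature.Probability.LatticeModels.CollarLegModel.ofDomain (V n)).Z‖)) ∧ Filter.Tendsto (fun n ↦ (Real.log (‖Literature.Probability.LatticeModels.CollarLegModel.Zins (V n) (⟨(Finset.univ.erase j).image (p n), fun v ↦ ∑ b ∈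 (Finset.univ.erase j).filter (fun b ↦ (p n) b = v), L b, (p n) j⟩ : Literature.Probability.LatticeModels.CollarLegModel.LegInsertionData)‖ / ‖(Literature.Probability.LatticeModels.CollarLegModel.ofDomain (V n)).Z‖) - (∑ i₁ : Fin k, ∑ i₂ ∈ Finset.univ.filter (fun i₂ : Fin k ↦ i₁ < i₂), (-((if i₁ = j then (1 - (L j : ℝ)) else (L i₁ : ℝ)) * (if i₂ = j then (1 - (L j : ℝ)) else (L i₂ : ℝ))) / 6) * Real.log (Literature.Probability.LatticeModels.dirichletGreen ((V n).image (fun v : ℤ × ℤ ↦ (![v.1, v.2] : Fin 2 → ℤ))) (![((p n) i₁).1, ((p n) i₁).2] : Fin 2 → ℤ) (![((p n) i₂).1, ((p n) i₂).2] : Fin 2 → ℤ)))) - (Real.log (‖Literature.Probability.LatticeModels.CollarLegModel.Zins (V' n) (⟨(Finset.univ.erase j).image (p' n), fun v ↦ ∑ b ∈ (Finset.univ.erase j).filter (fun b ↦ (p' n) b = v), L b, (p' n) j⟩ : Literature.Probability.LatticeModels.CollarLegModel.LegInsertionData)‖ / ‖(Literature.Probability.LatticeModels.CollarLegModel.ofDomain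 (V' n)).Z‖) - (∑ i₁ : Fin k, ∑ i₂ ∈ Finset.univ.filter (fun i₂ : Fin k ↦ i₁ < i₂), (-((if i₁ = j then (1 - (L j : ℝ)) else (L i₁ : ℝ)) * (if i₂ = j then (1 - (L j : ℝ)) else (L i₂ : ℝ))) / 6) * Real.log (Literature.Probability.LatticeModels.dirichletGreen ((V' n).image (fun v : ℤ × ℤ ↦ (![v.1, v.2] : Fin 2 → ℤ))) (![((p' n) i₁).1, ((p' n) i₁).2] : Fin 2 → ℤ) (![((p' n) i₂).1, ((p' n) i₂).2] : Fin 2 → ℤ))))) Filter.atTop (nhds 0) := by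
  sorry

/-- **Stub 2 — TALL-BOX LIMIT (sharpness, covariance-free; the integrable anchor).** Verbatim `stub_tallBoxLimit`
of stmt-14132's line: for every non-degenerate leg family ONE real `ℓ` such that along every mesh `δ_n → 0⁺` the
Green-normalised log insertion ratio of the canonical bottom-row configuration on the tall boxes
`[-W,W]×[-W,W·W]`, `W = ⌊1/δ_n⌋₊`, tends to `ℓ`. Plan (14132 line card T1–T4): link-pattern class identities of the
free-wall TL(1) stationary vector (qKZ / VSASM ground state: sum rule, extreme components, integral formulas),
asymptotics of the partial sums, Hamiltonian ↔ isotropic end-law universality, half-strip Green asymptotics.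
Certified ≥ crux 6 (sharp constant). Size XL, open. [cite: DiFrancescoZinnJustin2007]
[cite: MitraNienhuisDeGierBatchelor2004] -/
theorem stub_tallBoxLimit :
    ∀ (k : ℕ) (L : Fin k → ℕ) (j : Fin k), L j = ∑ i ∈ Finset.univ.erase j, L i → (∃ i, i ≠ j) → (∀ i, i ≠ j → 1 ≤ L i) → ∃ ℓ : ℝ, ∀ (δ : ℕ → ℝ), (∀ n, 0 < δ n) → Filter.Tendsto δ Filter.atTop (nhds 0) → ∀ (V : ℕ → Finset (ℤ × ℤ)), (∀ n, ∀ v : ℤ × ℤ, v ∈ V n ↔ (-(⌊1 / δ n⌋₊ : ℤ) ≤ v.1 ∧ v.1 ≤ ⌊1 / δ n⌋₊) ∧ (-(⌊1 / δ n⌋₊ : ℤ) ≤ v.2 ∧ v.2 ≤ (⌊1 / δ n⌋₊ : ℤ) * ⌊1 / δ n⌋₊)) → ∀ (p : ℕ → Fin k → ℤ × ℤ), (∀ n i, p n i = (⌊(2 * ((i : ℝ) + 1) / (k + 1) - 1) / δ n⌋, -(⌊1 / δ n⌋₊ : ℤ))) → (∀ n, Function.Injective (p n)) → (∀ n, Literature.Probability.LatticeModels.CollarLegModel.LegInsertionData.IsAdmissible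 (⟨(Finset.univ.erase j).image (p n), fun v ↦ ∑ b ∈ (Finset.univ.erase j).filter (fun b ↦ (p n) b = v), L b, (p n) j⟩ : Literature.Probability.LatticeModels.CollarLegModel.LegInsertionData) (V n)) → Filter.Tendsto (fun n ↦ (Real.log (‖Literature.Probability.LatticeModels.CollarLegModel.Zins (V n) (⟨(Finset.univ.erase j).image (p n), fun v ↦ ∑ b ∈ (Finset.univ.erase j).filter (fun b ↦ (p n) b = v), L b, (p n) j⟩ : Literature.Probability.LatticeModels.CollarLegModel.LegInsertionData)‖ / ‖(Literature.Probability.LatticeModels.CollarLegModel.ofDomain (V n)).Z‖) - (∑ i₁ : Fin k, ∑ i₂ ∈ Finset.univ.filter (fun i₂ : Fin k ↦ i₁ < i₂), (-((if i₁ = j then (1 - (L j : ℝ)) else (L i₁ : ℝ)) * (if i₂ = j then (1 - (L j : ℝ)) else (L i₂ : ℝ))) / 6) * Real.log (Literature.Probability.LatticeModels.dirichletGreen ((V n).image (fun v : ℤ × ℤ ↦ (![v.1, v.2] : Fin 2 → ℤ))) (![((p n) i₁).1, ((p n) i₁).2] : Fin 2 → ℤ) (![((p n) i₂).1, ((p n)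 i₂).2] : Fin 2 → ℤ))))) Filter.atTop (nhds ℓ) := by
  sorry

/-- **Stub 3 — ANCHOR TRANSFER (RSW technology, L–XL).** Verbatim `stub_anchorTransfer` of stmt-14132's line:
TALL-BOX LIMIT + RIGIDITY ⇒ the registered CANONICAL LIMIT on the squares `[-W,W]²` (rigidity compares the square
with every fixed-aspect box at equal mesh; the tall box differs from the aspect-`A` box only above height `2A`,
which a hull strand reaches at cost `e^{-cA}` on top of the local arm events — disjoint occurrence, arm separation
and extendability for alternating half-plane arm events; `log G_tall − log G_A = O(e^{-cA})` at bottom points).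
Falsifier (b) of the 14132 strategist PASSED (box → half-strip-end law deviation ≤ 1.5e-2·e^{-c(A−1)}).
[cite: Kesten1987] [cite: Nolin2008] -/
theorem stub_anchorTransfer :
    (∀ (k : ℕ) (L : Fin k → ℕ) (j : Fin k), L j = ∑ i ∈ Finset.univ.erase j, L i → (∃ i, i ≠ j) → (∀ i, i ≠ j → 1 ≤ L i) → ∃ ℓ : ℝ, ∀ (δ : ℕ → ℝ), (∀ n, 0 < δ n) → Filter.Tendsto δ Filter.atTop (nhds 0) → ∀ (V : ℕ → Finset (ℤ × ℤ)), (∀ n, ∀ v : ℤ × ℤ, v ∈ V n ↔ (-(⌊1 / δ n⌋₊ : ℤ) ≤ v.1 ∧ v.1 ≤ ⌊1 / δ n⌋₊) ∧ (-(⌊1 / δ n⌋₊ : ℤ) ≤ v.2 ∧ v.2 ≤ (⌊1 / δ n⌋₊ : ℤ) * ⌊1 / δ n⌋₊)) → ∀ (p : ℕ → Fin k → ℤ × ℤ), (∀ n i, p n i = (⌊(2 * ((i : ℝ) + 1) / (k + 1) - 1) / δ n⌋, -(⌊1 / δ n⌋₊ : ℤ))) → (∀ n, Function.Injective (p n)) →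 (∀ n, Literature.Probability.LatticeModels.CollarLegModel.LegInsertionData.IsAdmissible (⟨(Finset.univ.erase j).image (p n), fun v ↦ ∑ b ∈ (Finset.univ.erase j).filter (fun b ↦ (p n) b = v), L b, (p n) j⟩ : Literature.Probability.LatticeModels.CollarLegModel.LegInsertionData) (V n)) → Filter.Tendsto (fun n ↦ (Real.log (‖Literature.Probability.LatticeModels.CollarLegModel.Zins (V n) (⟨(Finset.univ.erase j).image (p n), fun v ↦ ∑ b ∈ (Finset.univ.erase j).filter (fun b ↦ (p n) b = v), L b, (p n) j⟩ : Literature.Probability.LatticeModels.CollarLegModel.LegInsertionData)‖ / ‖(Literature.Probability.LatticeModels.CollarLegModel.ofDomain (V n)).Z‖) - (∑ i₁ : Fin k, ∑ i₂ ∈ Finset.univ.filter (fun i₂ : Fin k ↦ i₁ < i₂), (-((if i₁ = j then (1 - (L j : ℝ)) else (L i₁ : ℝ)) * (if i₂ = j then (1 - (L j : ℝ)) else (L i₂ : ℝ))) / 6) * Real.log (Literature.Probability.LatticeModels.dirichletGreen ((V n).image (fun v : ℤ × ℤ ↦ (![v.1, v.2] : Fin 2 → ℤ))) (![((p n) i₁).1,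 ((p n) i₁).2] : Fin 2 → ℤ) (![((p n) i₂).1, ((p n) i₂).2] : Fin 2 → ℤ))))) Filter.atTop (nhds ℓ)) → (∀ (k : ℕ) (L : Fin k → ℕ) (j : Fin k), L j = ∑ i ∈ Finset.univ.erase j, L i → ∀ (D D' : Literature.Probability.RandomPlanarGeometry.MarkedDomain k), (∃ S : Finset (ℂ × ℂ), (∀ q ∈ S, q.1.re = q.2.re ∨ q.1.im = q.2.im) ∧ frontier D.carrier ⊆ ⋃ q ∈ S, segment ℝ q.1 q.2) → (∀ i, (∃ r : ℝ, 0 < r ∧ ((∀ z ∈ frontier D.carrier, dist z (D.pt i) < r → z.im = (D.pt i).im) ∨ (∀ z ∈ frontier D.carrier, dist z (D.pt i) < r → z.re = (D.pt i).re)))) → (∃ τ : ℂ, ‖τ‖ = 1 ∧ (∃ ε : ℝ, 0 < ε ∧ ∀ t ∈ Set.Ioo (D.mark j) (D.mark j + ε), ∃ s : ℝ, 0 < s ∧ D.boundary t = D.pt j + (s : ℂ) * τ) ∧ (∃ ε : ℝ, 0 < ε ∧ ∀ s ∈ Set.Ioo (0 : ℝ) ε, D.pt j + (s : ℂ) * (τ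 * Complex.I) ∈ D.carrier)) → (∃ S : Finset (ℂ × ℂ), (∀ q ∈ S, q.1.re = q.2.re ∨ q.1.im = q.2.im) ∧ frontier D'.carrier ⊆ ⋃ q ∈ S, segment ℝ q.1 q.2) → (∀ i, (∃ r : ℝ, 0 < r ∧ ((∀ z ∈ frontier D'.carrier, dist z (D'.pt i) < r → z.im = (D'.pt i).im) ∨ (∀ z ∈ frontier D'.carrier, dist z (D'.pt i) < r → z.re = (D'.pt i).re)))) → (∃ τ : ℂ, ‖τ‖ = 1 ∧ (∃ ε : ℝ, 0 < ε ∧ ∀ t ∈ Set.Ioo (D'.mark j) (D'.mark j + ε), ∃ s : ℝ, 0 < s ∧ D'.boundary t = D'.pt j + (s : ℂ) * τ) ∧ (∃ ε : ℝ, 0 < ε ∧ ∀ s ∈ Set.Ioo (0 : ℝ) ε, D'.pt j + (s : ℂ) * (τ * Complex.I) ∈ D'.carrier)) → ∀ (δ : ℕ → ℝ), (∀ n, 0 < δ n) → Filter.Tendsto δ Filter.atTop (nhds 0) → ∀ (V V' : ℕ → Finset (ℤ × ℤ)), (∀ n, ∀ v : ℤ × ℤ, v ∈ V n ↔ (((v).1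 : ℂ) * ((δ n : ℝ) : ℂ) + ((v).2 : ℂ) * ((δ n : ℝ) : ℂ) * Complex.I) ∈ closure D.carrier) → (∀ n, ∀ v : ℤ × ℤ, v ∈ V' n ↔ (((v).1 : ℂ) * ((δ n : ℝ) : ℂ) + ((v).2 : ℂ) * ((δ n : ℝ) : ℂ) * Complex.I) ∈ closure D'.carrier) → ∀ (p p' : ℕ → Fin k → ℤ × ℤ), (∀ n, Function.Injective ((p) n)) → (∀ n, Function.Injective ((p') n)) → (∀ i, Filter.Tendsto (fun n ↦ ((((p) n i).1 : ℂ) * ((δ n : ℝ) : ℂ) + (((p) n i).2 : ℂ) * ((δ n : ℝ) : ℂ) * Complex.I)) Filter.atTop (nhds (D.pt i))) → (∀ i, Filter.Tendsto (fun n ↦ ((((p') n i).1 : ℂ) * ((δ n : ℝ) : ℂ) + (((p') n i).2 : ℂ) * ((δ n : ℝ) : ℂ) * Complex.I)) Filter.atTop (nhds (D'.pt i))) → (∀ n, Literature.Probability.LatticeModels.CollarLegModel.LegInsertionData.IsAdmissible (⟨(Finset.univ.erase j).image ((p) n), fun v ↦ ∑ b ∈ (Finset.univ.erase j).filter (fun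 b ↦ ((p) n) b = v), L b, ((p) n) j⟩ : Literature.Probability.LatticeModels.CollarLegModel.LegInsertionData) (V n)) → (∀ n, Literature.Probability.LatticeModels.CollarLegModel.LegInsertionData.IsAdmissible (⟨(Finset.univ.erase j).image ((p') n), fun v ↦ ∑ b ∈ (Finset.univ.erase j).filter (fun b ↦ ((p') n) b = v), L b, ((p') n) j⟩ : Literature.Probability.LatticeModels.CollarLegModel.LegInsertionData) (V' n)) → (∀ᶠ n in Filter.atTop, 0 < (‖Literature.Probability.LatticeModels.CollarLegModel.Zins (V n) (⟨(Finset.univ.erase j).image (p n), fun v ↦ ∑ b ∈ (Finset.univ.erase j).filter (fun b ↦ (p n) b = v), L b, (p n) j⟩ : Literature.Probability.LatticeModels.CollarLegModel.LegInsertionData)‖ / ‖(Literature.Probability.LatticeModels.CollarLegModel.ofDomain (V n)).Z‖)) ∧ Filter.Tendsto (fun n ↦ (Real.log (‖Literature.Probability.LatticeModels.CollarLegModel.Zins (V n) (⟨(Finset.univ.erase j).image (p n), fun v ↦ ∑ b ∈ (Finset.univ.erase j).filter (fun b ↦ (p n) b = v), L b, (p n) j⟩ : Literature.Probability.LatticeModels.CollarLegModel.LegInsertionData)‖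 / ‖(Literature.Probability.LatticeModels.CollarLegModel.ofDomain (V n)).Z‖) - (∑ i₁ : Fin k, ∑ i₂ ∈ Finset.univ.filter (fun i₂ : Fin k ↦ i₁ < i₂), (-((if i₁ = j then (1 - (L j : ℝ)) else (L i₁ : ℝ)) * (if i₂ = j then (1 - (L j : ℝ)) else (L i₂ : ℝ))) / 6) * Real.log (Literature.Probability.LatticeModels.dirichletGreen ((V n).image (fun v : ℤ × ℤ ↦ (![v.1, v.2] : Fin 2 → ℤ))) (![((p n) i₁).1, ((p n) i₁).2] : Fin 2 → ℤ) (![((p n) i₂).1, ((p n) i₂).2] : Fin 2 → ℤ)))) - (Real.log (‖Literature.Probability.LatticeModels.CollarLegModel.Zins (V' n) (⟨(Finset.univ.erase j).image (p' n), fun v ↦ ∑ b ∈ (Finset.univ.erase j).filter (fun b ↦ (p' n) b = v), L b, (p' n) j⟩ : Literature.Probability.LatticeModels.CollarLegModel.LegInsertionData)‖ / ‖(Literature.Probability.LatticeModels.CollarLegModel.ofDomain (V' n)).Z‖) - (∑ i₁ : Fin k, ∑ i₂ ∈ Finset.univ.filter (fun i₂ : Fin k ↦ i₁ < i₂), (-((if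 i₁ = j then (1 - (L j : ℝ)) else (L i₁ : ℝ)) * (if i₂ = j then (1 - (L j : ℝ)) else (L i₂ : ℝ))) / 6) * Real.log (Literature.Probability.LatticeModels.dirichletGreen ((V' n).image (fun v : ℤ × ℤ ↦ (![v.1, v.2] : Fin 2 → ℤ))) (![((p' n) i₁).1, ((p' n) i₁).2] : Fin 2 → ℤ) (![((p' n) i₂).1, ((p' n) i₂).2] : Fin 2 → ℤ))))) Filter.atTop (nhds 0)) → ∀ (k : ℕ) (L : Fin k → ℕ) (j : Fin k), L j = ∑ i ∈ Finset.univ.erase j, L i → (∃ i, i ≠ j) → (∀ i, i ≠ j → 1 ≤ L i) → ∃ ℓ : ℝ, ∀ (δ : ℕ → ℝ), (∀ n, 0 < δ n) → Filter.Tendsto δ Filter.atTop (nhds 0) → ∀ (V : ℕ → Finset (ℤ × ℤ)), (∀ n, ∀ v : ℤ × ℤ, v ∈ V n ↔ (-(⌊1 / δ n⌋₊ : ℤ) ≤ v.1 ∧ v.1 ≤ ⌊1 / δ n⌋₊) ∧ (-(⌊1 / δ n⌋₊ : ℤ) ≤ v.2 ∧ v.2 ≤ ⌊1 / δ n⌋₊))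 → ∀ (p : ℕ → Fin k → ℤ × ℤ), (∀ n i, p n i = (⌊(2 * ((i : ℝ) + 1) / (k + 1) - 1) / δ n⌋, -(⌊1 / δ n⌋₊ : ℤ))) → (∀ n, Function.Injective (p n)) → (∀ n, Literature.Probability.LatticeModels.CollarLegModel.LegInsertionData.IsAdmissible (⟨(Finset.univ.erase j).image (p n), fun v ↦ ∑ b ∈ (Finset.univ.erase j).filter (fun b ↦ (p n) b = v), L b, (p n) j⟩ : Literature.Probability.LatticeModels.CollarLegModel.LegInsertionData) (V n)) → Filter.Tendsto (fun n ↦ (Real.log (‖Literature.Probability.LatticeModels.CollarLegModel.Zins (V n) (⟨(Finset.univ.erase j).image (p n), fun v ↦ ∑ b ∈ (Finset.univ.erase j).filter (fun b ↦ (p n) b = v), L b, (p n) j⟩ : Literature.Probability.LatticeModels.CollarLegModel.LegInsertionData)‖ / ‖(Literature.Probability.LatticeModels.CollarLegModel.ofDomain (V n)).Z‖) - (∑ i₁ : Fin k, ∑ i₂ ∈ Finset.univ.filter (fun i₂ : Fin k ↦ i₁ < i₂), (-((if i₁ = j then (1 - (L j : ℝ)) else (L i₁ : ℝ)) * (if i₂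 = j then (1 - (L j : ℝ)) else (L i₂ : ℝ))) / 6) * Real.log (Literature.Probability.LatticeModels.dirichletGreen ((V n).image (fun v : ℤ × ℤ ↦ (![v.1, v.2] : Fin 2 → ℤ))) (![((p n) i₁).1, ((p n) i₁).2] : Fin 2 → ℤ) (![((p n) i₂).1, ((p n) i₂).2] : Fin 2 → ℤ))))) Filter.atTop (nhds ℓ) := by
  sorry

/-- **The skeleton closes: the crux BY NAME from the three declared stubs.** Anchor transfer gives the canonical
limit; `refV2_of_canonicalLimit` ▸ `stub_transferV2` ▸ `greenKernelAsymptotics_of_facts` (landed, with the two proved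
Poisson-kernel facts) give the engine `BoundaryDefectGaussianR`; the landed bridge `DensityIntegration_proof`
gives Cardy's formula on rectilinear polygons. Depends on `sorryAx` exactly through the three stubs. [folklore] -/
theorem RectilinearCardy_of :
    Summit.CriticalPhenomena.CardyFormulaZ2.Theses.CardyBoundaryCoulombGas.RectilinearCardy :=
  Summit.CriticalPhenomena.CardyFormulaZ2.Theorems.DensityIntegration_proof
    (stub_transferV2 stub_rigidity
      (refV2_of_canonicalLimit stub_rigidity (stub_anchorTransfer stub_tallBoxLimit stub_rigidity))
      (greenKernelAsymptotics_of_facts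
        Literature.Probability.LatticeModels.Kenyon2000_flatEdgePoissonKernelLimit_holds
        Literature.Probability.LatticeModels.ChelkakSmirnov2011_boundaryNormalisedPoissonKernelLimit_holds))

/-- **Position 1: the stubs give the sub-problem** `CardyFormulaZ2` (crux ⟺ conjunct: proved support `RectilinearSuffices`).
Depends on `sorryAx` through the three stubs; the binder form is in `Lines/rigidity_tallbox_anchor_positions.lean`. [folklore] -/
theorem cardyFormulaZ2_of_stubs : _root_.CardyFormulaZ2 :=
  Summit.CriticalPhenomena.CardyFormulaZ2.Theorems.RectilinearSuffices_proof RectilinearCardy_of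

/-- **Position 2: where crux 6 sits.** TALL-BOX LIMIT + RIGIDITY through the ANCHOR TRANSFER give the canonical limit, hence
`HalfPlaneOneArmThird` by the landed certificate `halfPlaneOneArmThird_of_canonicalLimit` (depends on `sorryAx` through the stubs).
[folklore] -/
theorem halfPlaneOneArmThird_of_stubs :
    Summit.CriticalPhenomena.CardyFormulaZ2.Theses.CardyBoundaryCoulombGas.HalfPlaneOneArmThird :=
  halfPlaneOneArmThird_of_canonicalLimit (stub_anchorTransfer stub_tallBoxLimit stub_rigidity)

end Summit.CriticalPhenomena.CardyFormulaZ2.Cruxes.RectilinearCardy.RigidityTallBoxAnchor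

end
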